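import Summits.QuantumFields.YangMills.Theorems.BalabanUVNodesN16Thm1AtTorusVPSmallCubes
import Summits.QuantumFields.YangMills.Theorems.BalabanUVNodesN16H7OfN07RecordSlot
import HarnessLib

/-!
# Route «BalabanUVNodes», crux K3⁷ `SpineGivenEndpointR13SepCoPH` (stmt-QuantumFields-20544) — node N16 = NE3, in-edge N07 → N16:
# CONSEQUENCES OF `not_forall_thm1At_torusVP` FOR THE LOCATED TRANSFER `Thm1AtTransfer04to42` AND NODE N07's SLOT: at rank two the transfer can
# only hold when node N07's K1-side Theorem-1 sentence is FALSE, so the pair «K1 leaf of record ∧ transfer» is uninhabited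

Cell `pub-ymgap`, seat `pub-ymgap-dag-n16-w2` (WIDTH SEAT 2∕3 on node N16), generation g4, file 4 (v1.1 = v1.0 p609910 + §3, append-only).  `--kind proof --supports stmt-QuantumFields-20544 --as helper`
(count-neutral).  THEOREMS ONLY (0 `def`, 0 `sorry`, standard axioms).  Over `…N16Thm1AtTorusVPSmallCubes` (p608145) and dag-n16-w1's `…N16H7OfN07RecordSlot` (p588364:
`lipGauge`, `radiiMono_lipGauge'`, `interface_lipGauge'`, `Thm1AtTransfer04to42`) — CITED BY NAME, none edited.  Scope cut on the bus (INBOX «INTENT-4 AMENDED»): the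
all-rank ∕ `lipGauge` ∕ family-level corollaries are dag-n16-w5's (o3) file and are not declared here.

* §1 `not_consequent_thm1AtTransfer04to42_two` — at `N = 2` the CONSEQUENT of dag-n16-w1's located transfer hypothesis `Thm1AtTransfer04to42 F 2 ζ B`
  (`∃ C', … ∧ ∀ k, Thm1At C' (torusVP 4 F.L Nper (lipGauge 4 (Fin 2)) (k+1))`) is false: `lipGauge` is radii-monotone (`radiiMono_lipGauge'`) and supplies the first-order
  interface (`interface_lipGauge'`), so p608145's `not_forall_thm1At_torusVP` applies.  (The general `lipGauge` ∕ all-rank corollaries are dag-n16-w5's (o3) file, not restated here.)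
* §2 ★ `thm1AtTransfer04to42_two_iff_not` — `Thm1AtTransfer04to42 F 2 ζ B ↔ ¬ ∃ C, ∀ i : ZIdx, Thm1At C (varProblemT F 2 i.K i.k (ζ.R i))`: at rank two the «(0.4) → (42)
  transfer» holds EXACTLY WHEN node N07's K1-side Theorem-1 sentence at NODE 00's (0.4)-objects FAILS; ★ `not_b11Leaf_and_thm1AtTransfer04to42_two` — since the K1 leaf of record
  gives that sentence (`Node00.exists_thm1At_of_b11Leaf_Z11OfRecord`), `B11Leaf (Z11OfRecord F 2 ζ) ∧ Thm1AtTransfer04to42 F 2 ζ B` is FALSE for every `F ζ B` — the hypothesis pair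
  of `N16H7OfN07RecordSlot.h7Shape_loose_of_b11Leaf_Z11OfRecord_of_transfer` ∕ `h7_at_record_of_…_transfer_of_tightLeaf` and of dag-n16-e's module 46
  `N16PinnedLooseMatchOfN07Slot` (`∀ F, ∃ ζ B₀, B11Leaf … ∧ Thm1AtTransfer04to42 …`) is uninhabited at `N = 2` (`not_exists_b11Leaf_transfer_two`); the natural repair puts dag-n16-w1 g5's
  slot key in the transfer's consequent (owners' pens).
* §3 (v1.1) WHAT SURVIVES — `thm1At_torusVP_top_iff`: at the TRIVIAL gauge shape `⊤` («nothing asked»; radii-monotone, `radiiMono_top`; every cube `Gauged` with least factor `0`,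
  `regularity_torusVP_top`) `Thm1At C (torusVP d L N ⊤ k)` is EXACTLY clause (8) — a minimiser of run `k` over the closed class of radius `B₃ε₁` for every `0 < ε₁ ≤ a₁` and every
  datum with (7).  So the (8)-keyed consumers (`N16InteriorOfCapture.exists_isMinimiser_succ_of_thm1At_torusVP`, the CAPTURE files' `hT`-alone statements, dag-n16-w1 g5's (T8))
  keep an honest unrefuted instantiation `G := ⊤`, and the refuted content of `∀ k, Thm1At C (torusVP d L N G (k+1))` sits entirely in the `G`-slot read at small cubes.

HONEST FRAMING.  One-line consequences of p608145; what is refuted is leaf-06's all-cube reading D-s3-3 at rank two and the hypotheses typed over it — NOT [Balaban1985Variational]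
Theorem 1, NOT node N07's K1-side leaf `B11Leaf (Z11OfRecord …)` (about which nothing is claimed), NOT any registered K3⁷ v5 stub.  The repaired in-edge is the slot-cube key of dag-n16-w1 g5
(`…N16H7LooseOfReg910Slot`, (T9ˢ)+(T8)).  Nothing of Bałaban asserted; N16 ∕ N07 NOT discharged; counts UNMOVED (typed 28∕28 · discharged 5∕27 · A 5∕28); one finite four-torus at fixed
ε — R4 closes the conditional finite-𝕋⁴ rung `BalabanLadder.UV` only; the YM mass gap (Clay) is NOT proved by any of this; nothing continuum ∕ ℝ⁴ ∕ OS.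
-/

set_option autoImplicit false

open scoped BigOperators Matrix Matrix.Norms.L2Operator
open NormedSpace

namespace Summit.QuantumFields.YangMills.BalabanUVNodes.N16Thm1AtTorusVPSmallCubesConsequences

open Literature.MathematicalPhysics.QuantumFieldTheory.Balaban1983to89
open Literature.MathematicalPhysics.QuantumFieldTheory.Balaban1983to89.T4Continuum (T4Family)
open B7Prop1Explicit B7Prop2Explicit MatrixLog UnitaryModel
open T4AveragingDeficitWall hiding Site Plane Plaq Bond
open Summit.QuantumFields.BalabanUV.T4Continuum
open AveragingDeficitLatticeH2Prep (fd)
open MinimalActionSandwich (IsMinimiser)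
open MinimalActionRate (sfClass)
open MinimalActionDictionary (torusVP RadiiMono cubeM cubeM_pos gaugeFactors gaugeInf)
open B11 (Regularity)
open B11Thm1 (Thm1At)
open B11Thm1CarrierT (varProblemT)
open DagBinding (B11Leaf)
open Node00 (ne3NperOfRecord₁₁ MatA ZIdx ResidZ Z11OfRecord exists_thm1At_of_b11Leaf_Z11OfRecord)
open Summit.QuantumFields.YangMills.BalabanUVNodes.N16H7OfN07RecordSlot (lipGauge radiiMono_lipGauge' interface_lipGauge' Thm1AtTransfer04to42)
open Summit.QuantumFields.YangMills.BalabanUVNodes.N16Thm1AtTorusVPSmallCubes (not_forall_thm1At_torusVP)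

noncomputable section

/-! ## §1 At N16's objects (`N = 2`): the consequent of the located transfer hypothesis is false -/

/-- **THE CONSEQUENT OF `Thm1AtTransfer04to42 F 2 ζ B` IS FALSE** — there are no constants `C'` with `∀ k, Thm1At C' (torusVP 4 F.L Nper (lipGauge 4 (Fin 2)) (k+1))`:
dag-n16-w1's `lipGauge` is radii-monotone (`radiiMono_lipGauge'`) and supplies the first-order interface at cubes `K ≥ 2` (`interface_lipGauge'`, second differences dropped),
so `N16Thm1AtTorusVPSmallCubes.not_forall_thm1At_torusVP` applies at `(d, L, N) = (4, F.L, ne3NperOfRecord₁₁ F 0 0)`. [cite: Balaban1985Variational, Thm 1 (8)–(10) p.279] -/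
theorem not_consequent_thm1AtTransfer04to42_two (F : T4Family) (B : ℝ) :
    ¬ ∃ C' : B11Thm1.Consts, C'.B₃ ≤ B ∧ (∀ e : ℝ, 0 < e → e ≤ C'.a₁ → 7 / 2 ≤ C'.Mfun e) ∧
      ∀ k : ℕ, Thm1At C' (torusVP 4 F.L (ne3NperOfRecord₁₁ F 0 0) (lipGauge 4 (Fin 2)) (k + 1)) := by
  rintro ⟨C', -, -, hT⟩
  have h01 : (0 : Fin 4) ≠ 1 := by decide
  refine not_forall_thm1At_torusVP h01 F.hL.2 (ne3NperOfRecord₁₁ F 0 0) radiiMono_lipGauge' (fun U x K α₀ α₁ α₂ hK hGU => ?_) C' hT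
  obtain ⟨u, a, hu, hexp, h0, h1, -⟩ := interface_lipGauge' U x K α₀ α₁ α₂ hK hGU
  exact ⟨u, a, hu, hexp, h0, h1⟩

/-! ## §2 The transfer ⟺ NOT (node N07's K1-side Theorem-1 sentence); the pair «K1 leaf ∧ transfer» is uninhabited -/

/-- **★ AT RANK TWO THE «(0.4) → (42) TRANSFER» HOLDS EXACTLY WHEN NODE N07's K1-SIDE THEOREM-1 SENTENCE FAILS**: `Thm1AtTransfer04to42 F 2 ζ B` is an implication whose
consequent is false (§1), so it is equivalent to the negation of its antecedent `∃ C, ∀ i : ZIdx, Thm1At C (varProblemT F 2 i.K i.k (ζ.R i))` ([Balaban1985Variational] Thm 1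
at NODE 00's (0.4)-objects — node N07's content, about which NOTHING is claimed here). [folklore] -/
theorem thm1AtTransfer04to42_two_iff_not (F : T4Family) (ζ : ResidZ F 2) (B : ℝ) :
    Thm1AtTransfer04to42 F 2 ζ B ↔ ¬ ∃ C : B11Thm1.Consts, ∀ i : ZIdx, Thm1At C (varProblemT F 2 i.K i.k (ζ.R i)) :=
  ⟨fun hT hA => not_consequent_thm1AtTransfer04to42_two F B (hT hA), fun hn hA => absurd hA hn⟩

/-- **★ `B11Leaf (Z11OfRecord F 2 ζ) ∧ Thm1AtTransfer04to42 F 2 ζ B` IS FALSE** (every `F ζ B`): the K1 leaf of record gives node N07's Theorem-1 sentence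
(`Node00.exists_thm1At_of_b11Leaf_Z11OfRecord`), the transfer would carry it to the refuted torus reading.  This is the hypothesis pair of
`N16H7OfN07RecordSlot.h7Shape_loose_of_b11Leaf_Z11OfRecord_of_transfer` and of dag-n16-e's module 46 at `N = 2`. [folklore] -/
theorem not_b11Leaf_and_thm1AtTransfer04to42_two (F : T4Family) (ζ : ResidZ F 2) (B : ℝ) :
    ¬ (B11Leaf (Z11OfRecord F 2 ζ) ∧ Thm1AtTransfer04to42 F 2 ζ B) := by
  rintro ⟨h07, hT⟩
  exact (thm1AtTransfer04to42_two_iff_not F ζ B).1 hT (exists_thm1At_of_b11Leaf_Z11OfRecord h07)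

/-- Hence module 46's per-family hypothesis `∃ ζ B₀, B11Leaf (Z11OfRecord F N ζ) ∧ Thm1AtTransfer04to42 F N ζ B₀` is uninhabited at `N = 2`, for every family `F`. [folklore] -/
theorem not_exists_b11Leaf_transfer_two (F : T4Family) :
    ¬ ∃ (ζ : ResidZ F 2) (B : ℝ), B11Leaf (Z11OfRecord F 2 ζ) ∧ Thm1AtTransfer04to42 F 2 ζ B := by
  rintro ⟨ζ, B, h⟩
  exact not_b11Leaf_and_thm1AtTransfer04to42_two F ζ B h

/-! ## §3 What survives: the (8) clause, keyed at the trivial gauge shape `⊤` (v1.1) -/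

section TopShape

variable {d : ℕ} {n : Type} [Fintype n] [DecidableEq n]

/-- The trivial local-gauge shape `⊤` («nothing asked») is radii-monotone. [folklore] -/
theorem radiiMono_top : RadiiMono d (fun (_ : Site d → Fin d → (Matrix n n ℂ)ˣ) (_ : Site d) (_ : ℕ) (_ _ _ : ℝ) => True) :=
  fun _ _ _ _ _ _ _ _ _ _ _ _ _ => trivial

/-- At the trivial shape every cube is `Gauged` with least factor `0`, so r2's `Regularity` holds for every cube of positive size parameter
whenever `B₃, B₄, ε₁ > 0` (`L ≥ 1`). [folklore] -/
theorem regularity_torusVP_top {L N k : ℕ} (hL : 1 ≤ L) {B₃ B₄ ε₁ : ℝ} (hB₃ : 0 < B₃) (hB₄ : 0 < B₄) (hε₁ : 0 < ε₁)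
    (U : Site d → Fin d → (Matrix n n ℂ)ˣ) (c : Site d × ℕ) :
    Regularity (torusVP d L N (fun (_ : Site d → Fin d → (Matrix n n ℂ)ˣ) (_ : Site d) (_ : ℕ) (_ _ _ : ℝ) => True) k) B₃ B₄ ε₁ U c := by
  have hL0 : (L : ℝ) ≠ 0 := by exact_mod_cast (by omega : L ≠ 0)
  have hfac : ((L : ℝ) ^ k * ((L : ℝ) ^ k)⁻¹) = 1 := mul_inv_cancel₀ (pow_ne_zero _ hL0)
  have hM : 0 < cubeM L k c.2 := cubeM_pos hL k c.2
  have hset : gaugeFactors (fun (_ : Site d → Fin d → (Matrix n n ℂ)ˣ) (_ : Site d) (_ : ℕ) (_ _ _ : ℝ) => True) L k U c.1 c.2 = Set.Ici 0 := by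
    ext t; simp [gaugeFactors, Set.mem_Ici]
  have hinf : gaugeInf (fun (_ : Site d → Fin d → (Matrix n n ℂ)ˣ) (_ : Site d) (_ : ℕ) (_ _ _ : ℝ) => True) L k U c.1 c.2 = 0 := by
    rw [gaugeInf, hset, csInf_Ici]
  refine ⟨?_, ?_, ?_, ?_, ?_⟩
  · show (gaugeFactors _ L k U c.1 c.2).Nonempty
    rw [hset]; exact ⟨0, Set.mem_Ici.mpr le_rfl⟩
  · show gaugeInf _ L k U c.1 c.2 < B₃ * cubeM L k c.2 * ε₁ * ((L : ℝ) ^ k * ((L : ℝ) ^ k)⁻¹)⁻¹ ^ 1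
    rw [hinf, hfac, inv_one, one_pow, mul_one]; positivity
  · show gaugeInf _ L k U c.1 c.2 < B₃ * cubeM L k c.2 * ε₁ * ((L : ℝ) ^ k * ((L : ℝ) ^ k)⁻¹)⁻¹ ^ 2
    rw [hinf, hfac, inv_one, one_pow, mul_one]; positivity
  · intro β hβ0 _
    show (0 : ℝ) < B₄ * cubeM L k c.2 * ε₁ * (((L : ℝ) ^ k * ((L : ℝ) ^ k)⁻¹)⁻¹) ^ (2 + β)
    rw [hfac, inv_one, Real.one_rpow, mul_one]; positivity
  · show gaugeInf _ L k U c.1 c.2 < B₃ * cubeM L k c.2 * ε₁ * ((L : ℝ) ^ k * ((L : ℝ) ^ k)⁻¹)⁻¹ ^ 3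
    rw [hinf, hfac, inv_one, one_pow, mul_one]; positivity

/-- **WHAT SURVIVES OF THE TORUS READING: `Thm1At` AT THE TRIVIAL SHAPE `⊤` IS EXACTLY CLAUSE (8)** — existence, for every `0 < ε₁ ≤ a₁` and every datum with (7), of a
minimiser of run `k` over the closed class of radius `B₃ε₁` with that datum (`Unique6` is `True` for `torusVP`, D-s3-5; `Reg910` is free at `⊤`, `regularity_torusVP_top`).
So the (8)-keyed consumers (`exists_isMinimiser_succ_of_thm1At_torusVP`, the CAPTURE files' `hT`-alone statements) keep an honest, unrefuted instantiation `G := ⊤`; the refuted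
content of `∀ k, Thm1At C (torusVP d L N G (k+1))` sits entirely in the `G`-slot read at small cubes. [cite: Balaban1985Variational, Thm 1 (8) p.279] -/
theorem thm1At_torusVP_top_iff {L N : ℕ} (hL : 1 ≤ L) (C : B11Thm1.Consts) (k : ℕ) :
    Thm1At C (torusVP d L N (fun (_ : Site d → Fin d → (Matrix n n ℂ)ˣ) (_ : Site d) (_ : ℕ) (_ _ _ : ℝ) => True) k) ↔
      ∀ ε₁ : ℝ, 0 < ε₁ → ε₁ ≤ C.a₁ → ∀ V : Site d → Fin d → (Matrix n n ℂ)ˣ, V ∈ sfClass d L N ε₁ 0 →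
        ∃ U : Site d → Fin d → (Matrix n n ℂ)ˣ, U ∈ sfClass d L N (C.B₃ * ε₁) k ∧ avgIter L U k = V ∧
          IsMinimiser d (sfClass d L N (C.B₃ * ε₁)) L N k V U := by
  constructor
  · intro hT ε₁ h₁ h₂ V hV
    exact (hT ε₁ h₁ h₂ V hV).1
  · intro h ε₁ h₁ h₂ V hV
    refine ⟨h ε₁ h₁ h₂ V hV, fun _ _ _ _ _ => trivial, fun U _ c _ => ?_⟩
    exact regularity_torusVP_top hL C.B₃_pos C.B₄_pos h₁ U c

end TopShape

end

end Summit.QuantumFields.YangMills.BalabanUVNodes.N16Thm1AtTorusVPSmallCubesConsequences
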